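import Literature.Geometry.Lorentzian.SpacetimeLocalConvergence
import Literature.Geometry.Lorentzian.Stationary
import Literature.Geometry.Lorentzian.LorentzianDistance
import Literature.Geometry.Lorentzian.CoordCurvature
import Literature.Geometry.Lorentzian.KerrSchild
import Summits.FinalStateConjecture.FinalStateConjecture.Statement
import HarnessLib

/-!
# Route PhotonSphereChannels · crux `ChannelsResolveTameDevelopmentsR` (stmt-FinalStateConjecture-14075) —
# posited objects of the line `trapped-set-observability-analyticity`, part 1: the ω-limit object
# `TameEternalLimit` (route-posited definitions, D-0016 `<Route>Defs` convention; pattern of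
# `PhotonSphereChannelsTameHullDefs.lean`)

This file carries no mathematics beyond definitions and a small vacuity API (§API). It is the first
half of the vocabulary over which the seven registered stubs of the line
`trapped-set-observability-analyticity` of crux stmt-FinalStateConjecture-14075 are stated (skeleton
`Cruxes/ChannelsResolveTameDevelopmentsR/Lines/trapped_set_observability_analyticity.lean`, planner
planner-cruxplan-stmt-FinalStateConjecture-14075-trapped-set-observab-0; lead
prover-line-stmt-FinalStateConjecture-14075-c1-0), moved VERBATIM (same names, same bodies, same
docstrings) out of the crux workfile so that stub helpers can be landed as `Theorems/…` files
(`--supports stmt-FinalStateConjecture-14075`) importing it. §1 is the vocabulary SHARED with line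
`limit-bifurcation-sphere-hawking-collar` (crux 10046): the hypotheses of Φ as predicates
(`NoExtremalRemnant`, `TameOuterRegion`), `outerRegion`, `IsEscaping`, `TameClockChartAt`,
`farBackground`, and the ω-limit object `TameEternalLimit` with
`doc / horizon / RedShifted / IsKerrBlackHole / IsFlat / ArisesFrom`. §API records that the red-shift
predicate is VACUOUS on horizonless limits (`TameEternalLimit.redShifted_of_horizon_eq_empty`,
registered sub-goal `stub_redShiftedOfHorizonEmpty`) — it is the conclusion of stub S2 and the
hypothesis of S3/S6. Part 2 (`PhotonSphereChannelsPresentedExteriorDefs.lean`) carries the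
presented-coordinates vocabulary of the line proper.

Everything is a definition over EXISTING Literature declarations (`Spacetime`, `ModelBackground`,
`Kerr.region/radius/bilin/rPlus`, `Spacetime.deviation(Extend)`, `IsLateChart`, `supCkENorm`,
`Spacetime.docOfEnd`, `Spacetime.futureEventHorizonOfEnd`, `Spacetime.lorentzDist`,
`Spacetime.SubconvergesLocallyWithFarChartsTo`, `VacuumCauchyDevelopment`,
`Summit.FinalStateConjecture.HasCompleteNullInfinity`); nothing here restates a route item (the stubs
stay in the crux workfile until proved; the consequent Φ = `TameResolution` stays there too). This
module deliberately does NOT import the route file `Theses.PhotonSphereChannels`.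
-/

set_option linter.dupNamespace false

noncomputable section

namespace Summit.FinalStateConjecture.FinalStateConjecture.Theorems.TrappedSet

open Literature.Geometry.Lorentzian
open scoped Manifold ContDiff Topology ENNReal NNReal BigOperators
open Filter Set Function TopologicalSpace MeasureTheory

/-! ## §1 Vocabulary shared with line `limit-bifurcation-sphere-hawking-collar` (crux 10046)

VERBATIM copies (same names, same bodies) of that line's hypotheses-as-predicates, outer region,
escaping sequences, clock-adapted tame charts, far background and the bundled ω-limit object
`TameEternalLimit` with `doc` / `horizon` / `RedShifted` / `IsKerrBlackHole` / `IsFlat` /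
`ArisesFrom` — so that S1, S2, S7 below are that line's S1, S2, S7 by signature (shared staffing; the
triage of both cruxes read these clauses). -/

section Vocabulary

variable {X : Type} [TopologicalSpace X] [ChartedSpace Literature.Geometry.Lorentzian.E3 X]
  [IsManifold (modelWithCornersSelf ℝ Literature.Geometry.Lorentzian.E3) ((⊤ : ℕ∞) : WithTop ℕ∞) X]
  [ConnectedSpace X] {D : Literature.Geometry.Lorentzian.InitialDataSet (modelWithCornersSelf ℝ Literature.Geometry.Lorentzian.E3) X}

/-- Hypothesis (i) of `Φ`, verbatim: **no extremal remnant** — no late-time chart from a boosted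
extremal Kerr exterior along which the `C²` deviation tends to `0` on every near-zone slab.
[cite: DafermosLuk2017, Conjecture 1] -/
def NoExtremalRemnant (𝒟 : Literature.Geometry.Lorentzian.VacuumCauchyDevelopment D) : Prop :=
  ∀ (Λ : Literature.Geometry.Lorentzian.lorentzGroup) (c : Literature.Geometry.Lorentzian.E4) (M a : ℝ), Literature.Geometry.Lorentzian.Kerr.IsExtremal M a → ¬ ∃ (τ₀ : ℝ) (Ψ : (Literature.Geometry.Lorentzian.boostedKerrBackground Λ c M a).domain → 𝒟.carrier), 𝒟.toSpacetime.IsLateChart (Literature.Geometry.Lorentzian.boostedKerrBackground Λ c M a) Set.univ τ₀ Ψ ∧ ∀ R : ℝ, Filter.Tendsto (fun τ => 𝒟.toSpacetime.truncDeviationCk (Literature.Geometry.Lorentzian.boostedKerrBackground Λ c M a) Ψ 2 R τ) Filter.atTop (nhds 0)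

/-- Hypothesis (ii) of `Φ`, verbatim: **the outer region is uniformly `C³`-tame** (bounded geometry
in `C⁰`-pinched coordinate balls of a fixed radius `r₀` about every point of
`J⁺(Σ) ∩ ⋃ I⁻(future branches of future-complete normalised null rays from Σ)`).
[cite: DafermosLuk2017, §1.2.1] -/
def TameOuterRegion (𝒟 : Literature.Geometry.Lorentzian.VacuumCauchyDevelopment D) : Prop :=
  ∀ [𝒟.metric.HasLeviCivita], let outer : Set 𝒟.carrier := 𝒟.metric.causalFuture 𝒟.timeOrientation (Set.range 𝒟.embed) ∩ {q | ∃ (p : X) (γ : ℝ → 𝒟.carrier) (dom : Set ℝ), 𝒟.metric.IsNormalisedNullRayFrom 𝒟.timeOrientation 𝒟.embed 𝒟.normal p γ dom ∧ ¬ BddAbove dom ∧ q ∈ 𝒟.metric.chronologicalPast 𝒟.timeOrientation (γ '' (dom ∩ Set.Ici 0))}; ∃ r₀ : ℝ, 0 < r₀ ∧ ∃ Λ : NNReal, ∀ q ∈ outer, let U : TopologicalSpace.Opens Literature.Geometry.Lorentzian.E4 := ⟨Metric.ball (0 : Literature.Geometry.Lorentzian.E4) r₀, Metric.isOpen_ball⟩;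 ∃ Ψ : U → 𝒟.carrier, 𝒟.toSpacetime.IsLateChart (Literature.Geometry.Lorentzian.Minkowski.backgroundOn U) Set.univ (-r₀) Ψ ∧ (∃ x : U, (x : Literature.Geometry.Lorentzian.E4) = 0 ∧ Ψ x = q) ∧ Literature.Geometry.Lorentzian.supCkENorm (U : Set Literature.Geometry.Lorentzian.E4) 3 (𝒟.toSpacetime.deviationExtend (Literature.Geometry.Lorentzian.Minkowski.backgroundOn U) Ψ) ≤ (Λ : ENNReal) ∧ Literature.Geometry.Lorentzian.supCkENorm (U : Set Literature.Geometry.Lorentzian.E4) 0 (𝒟.toSpacetime.deviationExtend (Literature.Geometry.Lorentzian.Minkowski.backgroundOn U) Ψ) ≤ 1 / 2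

/-- The **outer region** `J⁺(Σ) ∩ ⋃ I⁻(future branch of a future-complete normalised null ray
from Σ)` of a Cauchy development (the set `outer` of hypothesis (ii); it contains the domain of outer
communications). [cite: DafermosLuk2017, §1.2.1] -/
def outerRegion (𝒟 : Literature.Geometry.Lorentzian.CauchyDevelopment D) [𝒟.metric.HasLeviCivita] :
    Set 𝒟.carrier :=
  𝒟.metric.causalFuture 𝒟.timeOrientation (Set.range 𝒟.embed) ∩ {q | ∃ (p : X) (γ : ℝ → 𝒟.carrier) (dom : Set ℝ), 𝒟.metric.IsNormalisedNullRayFrom 𝒟.timeOrientation 𝒟.embed 𝒟.normal p γ dom ∧ ¬ BddAbove dom ∧ q ∈ 𝒟.metric.chronologicalPast 𝒟.timeOrientation (γ '' (dom ∩ Set.Ici 0))}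

/-- A sequence of events `p : ℕ → M` of a Cauchy development **escapes to the future**: its
time-separation (Lorentzian distance, `Spacetime.lorentzDist`) from the Cauchy hypersurface `ι(X)`
tends to `+∞` — for every `T`, eventually some point of `ι(X)` lies at time-separation `≥ T` to the
past of `p n`.  These are the base-point sequences along which late-time ω-limits are taken.
[cite: ONeillSemiRiemannian1983, Ch. 14, Def. 14.15 (p. 409)] -/
def IsEscaping (𝒟 : Literature.Geometry.Lorentzian.CauchyDevelopment D) (p : ℕ → 𝒟.carrier) : Prop :=
  ∀ T : ℝ, ∀ᶠ n in Filter.atTop, ∃ x : X, ENNReal.ofReal T ≤ 𝒟.toSpacetime.lorentzDist (𝒟.embed x) (p n)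

end Vocabulary

/-- A **`C^k`-tame chart at `q` adapted to the clock `t`** of the spacetime `𝓢`: the per-point clause
of hypothesis (ii) with `3 ↦ k` — a smooth late chart `Ψ` of the Minkowski background on the
coordinate ball `B(0, r₀) ⊆ E4`, centred at `q` (`Ψ 0 = q`), with `‖Ψ^* g − η‖_{C^k(B)} ≤ Λ` and
`‖Ψ^* g − η‖_{C⁰(B)} ≤ 1/2` — IN WHICH THE CLOCK IS COORDINATE TIME: `t (Ψ x) = t q + x⁰`.  The last
clause is the triage-demanded tie between the red-shift clock and the tame charts (with a free clock
the surface gravity of a dynamical horizon is a free reparametrisation, `RedShiftedHorizon.lean`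
module docstring); since `Ψ^* g` is `C⁰`-pinched to `η`, `x⁰` — hence `t` — is a time function with
uniformly timelike, uniformly bounded gradient. [cite: arXiv210408222, §1] [cite: DafermosRodnianski2008, §7.1] -/
def TameClockChartAt (𝓢 : Literature.Geometry.Lorentzian.Spacetime.{0} 4) (t : 𝓢.carrier → ℝ) (k : ℕ)
    (r₀ : ℝ) (Λ : NNReal) (q : 𝓢.carrier) : Prop :=
  let U : TopologicalSpace.Opens Literature.Geometry.Lorentzian.E4 := ⟨Metric.ball (0 : Literature.Geometry.Lorentzian.E4) r₀, Metric.isOpen_ball⟩; ∃ Ψ : U → 𝓢.carrier, 𝓢.IsLateChart (Literature.Geometry.Lorentzian.Minkowski.backgroundOn U) Set.univ (-r₀) Ψ ∧ (∃ x : U, (x : Literature.Geometry.Lorentzian.E4) = 0 ∧ Ψ x = q) ∧ Literature.Geometry.Lorentzian.supCkENorm (U : Set Literature.Geometry.Lorentzian.E4) k (𝓢.deviationExtend (Literature.Geometry.Lorentzian.Minkowski.backgroundOn U) Ψ) ≤ (Λ : ENNReal) ∧ Literature.Geometry.Lorentzian.supCkENorm (U : Set Literature.Geometry.Lorentzian.E4)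 0 (𝓢.deviationExtend (Literature.Geometry.Lorentzian.Minkowski.backgroundOn U) Ψ) ≤ 1 / 2 ∧ ∀ x : U, t (Ψ x) = t q + (x : Literature.Geometry.Lorentzian.E4) 0

/-- The **eternal far background** `(ℝ_t × {|x| > R}, g_{M,0}, x⁰, |x|)`: the cylinder
`Kerr.region 0 R` with the ingoing Kerr–Schild (Eddington–Finkelstein) Schwarzschild form of mass
`M` — exactly the `let B` of `FarZoneEternalPapapetrou` (stmt-10034). [cite: arXiv08110354, §5.1] -/
def farBackground (M R : ℝ) : Literature.Geometry.Lorentzian.ModelBackground :=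
  ⟨Literature.Geometry.Lorentzian.Kerr.region 0 R, Literature.Geometry.Lorentzian.Kerr.bilin M 0, fun x ↦ x 0, Literature.Geometry.Lorentzian.Kerr.radius 0⟩

/-- **The ω-limit object of the line: a tame eternal limit.**  A smooth time-oriented Lorentzian
`4`-manifold `Z` with a base point `z`, carried by

* an ETERNAL FAR CHART `Φ : ℝ_t × {|x| > R} → Z` (injective local diffeomorphism) in which the
  deviation `h = Φ^* g − g_{M,0}` from Schwarzschild of mass `M ≥ 0` obeys `‖D^m h‖·r ≤ C_k` for all
  `m ≤ k`, for EVERY `k`, uniformly in `t ∈ ℝ`, and is TWO-SIDED NON-RADIATING at order `1/r`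
  (`r‖D^m ∂₀h‖ → 0` as `r → ∞` uniformly in `t`, every `m`) — verbatim the hypotheses of
  `FarZoneEternalPapapetrou` at every order;
* a smooth global CLOCK `t : Z → ℝ` equal to far-chart time on the far zone;
* `C^k`-TAMENESS FOR EVERY `k` in clock-adapted charts (`TameClockChartAt`) about every point of the
  closure of the domain of outer communications `⟨⟨Φ⟩⟩ = I⁺(range Φ) ∩ I⁻(range Φ)` of the far end;
* the vacuum equations, global hyperbolicity, `Z ⊆ I⁺(range Φ)` (no white-hole junk), and
  `z ∈ closure ⟨⟨Φ⟩⟩`;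
* HORIZON STRUCTURE: the future event horizon `𝓗 = ∂I⁻(range Φ) ∩ I⁺(range Φ)` of the far end
  (`Spacetime.futureEventHorizonOfEnd`; possibly EMPTY — the horizonless/dispersive limits) is
  generated by a vector field `L`, smooth near `𝓗`, future-directed null on `𝓗`, normalised by the
  clock `dt(L) = 1`, tangent to `𝓗` (whole-line integral curves starting on `𝓗` stay on `𝓗`),
  COMPLETE on `𝓗` (through every horizon point passes a whole-line integral curve: the horizon is
  eternal, its generators have no past end points in `Z`, no creases), REGULAR (`𝓗` is the zero set
  of a smooth function `f` on a neighbourhood, with `ker df_p = L_p^⊥` at horizon points: a smooth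
  embedded NULL hypersurface with null normal `L`), with COMPACT clock-sections `𝓗 ∩ {t = c}`, and
  NON-EXPANDING & SHEAR-FREE (`g(∇_Y L, W) + g(Y, ∇_W L) = 0` for `Y, W ⊥ L`, i.e. tangent, at
  horizon points).  (Triage r1-1/r1-2: these clauses exclude the single-geodesic / sandwich-wave
  junk instances of the card's first lemma — `𝓗` is the genuine event horizon of an asymptotically
  flat far end.)

The surface gravity of `L` is NOT part of the structure (it is the output of `stub_kappaFloor`).
These are exactly the inputs the lever consumes; `stub_omegaLimits` asserts that late-time limits of
tame developments can be so packaged.  (Cheeger–Gromov limits: Petersen 2006, Ch. 10 §3.2; d.o.c. /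
event horizon of an end: Chruściel–Costa 2008, (2.2)–(2.5); non-expanding horizons:
Ashtekar–Beetle–Lewandowski gr-qc/0111067, §2.) [cite: Petersen2006, Ch. 10 §3.2] -/
structure TameEternalLimit where
  /-- The limit spacetime. -/
  Z : Literature.Geometry.Lorentzian.Spacetime.{0} 4
  /-- The base point of the pointed limit. -/
  z : Z.carrier
  /-- The Schwarzschild mass parameter of the far chart (`M = 0` for dispersive limits). -/
  M : ℝ
  /-- The inner radius of the far chart. -/
  R : ℝ
  /-- The eternal far chart on the cylinder `ℝ_t × {|x| > R}`. -/
  Φ : Literature.Geometry.Lorentzian.Kerr.region (0 : ℝ) R → Z.carrier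
  /-- The global clock. -/
  t : Z.carrier → ℝ
  /-- The clock-normalised generator field of the horizon (extended smoothly near it). -/
  L : Π x : Z.carrier, TangentSpace (𝓡 4) x
  mass_nonneg : 0 ≤ M
  lt_R : max (2 * M) 0 < R
  isRicciFlat : ∀ [Z.metric.toPseudoRiemannianMetric.HasLeviCivita], Z.metric.toPseudoRiemannianMetric.IsRicciFlat
  isGloballyHyperbolic : Z.metric.IsGloballyHyperbolic Z.timeOrientation
  subset_chronologicalFuture : (Set.univ : Set Z.carrier) ⊆ Z.metric.chronologicalFuture Z.timeOrientation (Set.range Φ)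
  isLocalDiffeomorph_far : IsLocalDiffeomorph 𝓘(ℝ, Literature.Geometry.Lorentzian.E4) (𝓡 4) (⊤ : ℕ∞) Φ
  injective_far : Function.Injective Φ
  far_bounds : ∀ k : ℕ, ∃ C : ℝ, ∀ m ≤ k, ∀ x : Literature.Geometry.Lorentzian.Kerr.region (0 : ℝ) R, ‖iteratedFDeriv ℝ m (Z.deviationExtend (farBackground M R) Φ) x.1‖ * Literature.Geometry.Lorentzian.Kerr.radius 0 x.1 ≤ C
  far_nonradiating : ∀ (m : ℕ), ∀ δ > (0 : ℝ), ∃ R' : ℝ, ∀ x : Literature.Geometry.Lorentzian.Kerr.region (0 : ℝ) R, R' < Literature.Geometry.Lorentzian.Kerr.radius 0 x.1 → ‖iteratedFDeriv ℝ m (fun y ↦ fderiv ℝ (Z.deviationExtend (farBackground M R) Φ) y (Literature.Geometry.Lorentzian.E4.basisVector 0)) x.1‖ * Literature.Geometry.Lorentzian.Kerr.radius 0 x.1 ≤ δ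
  far_clock : ∀ x : Literature.Geometry.Lorentzian.Kerr.region (0 : ℝ) R, t (Φ x) = x.1 0
  contMDiff_clock : ContMDiff (𝓡 4) 𝓘(ℝ, ℝ) (⊤ : ℕ∞) t
  tame : ∀ k : ℕ, ∃ r₀ : ℝ, 0 < r₀ ∧ ∃ Λ : NNReal, ∀ q ∈ closure (Z.docOfEnd (Set.range Φ)), TameClockChartAt Z t k r₀ Λ q
  basepoint_mem : z ∈ closure (Z.docOfEnd (Set.range Φ))
  contMDiffOn_generator : ∃ 𝒩 : Set Z.carrier, IsOpen 𝒩 ∧ Z.futureEventHorizonOfEnd (Set.range Φ) ⊆ 𝒩 ∧ ContMDiffOn (𝓡 4) ((𝓡 4).prod 𝓘(ℝ, Literature.Geometry.Lorentzian.E4)) (⊤ : ℕ∞) (fun x ↦ (Bundle.TotalSpace.mk' Literature.Geometry.Lorentzian.E4 x (L x) : TangentBundle (𝓡 4) Z.carrier)) 𝒩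
  generator_null : ∀ p ∈ Z.futureEventHorizonOfEnd (Set.range Φ), Z.metric.IsNull (L p) ∧ Z.timeOrientation.IsFutureDirected (L p) ∧ mvfderiv (𝓡 4) t p (L p) = 1
  generator_tangent : ∀ γ : ℝ → Z.carrier, IsMIntegralCurve γ L → γ 0 ∈ Z.futureEventHorizonOfEnd (Set.range Φ) → ∀ s : ℝ, γ s ∈ Z.futureEventHorizonOfEnd (Set.range Φ)
  generator_complete : ∀ p ∈ Z.futureEventHorizonOfEnd (Set.range Φ), ∃ γ : ℝ → Z.carrier, IsMIntegralCurve γ L ∧ γ 0 = p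
  horizon_regular : ∃ (𝒩 : Set Z.carrier) (f : Z.carrier → ℝ), IsOpen 𝒩 ∧ Z.futureEventHorizonOfEnd (Set.range Φ) ⊆ 𝒩 ∧ ContMDiffOn (𝓡 4) 𝓘(ℝ, ℝ) (⊤ : ℕ∞) f 𝒩 ∧ Z.futureEventHorizonOfEnd (Set.range Φ) = {p | p ∈ 𝒩 ∧ f p = 0} ∧ ∀ p ∈ Z.futureEventHorizonOfEnd (Set.range Φ), ∀ v : TangentSpace (𝓡 4) p, mfderiv (𝓡 4) 𝓘(ℝ, ℝ) f p v = 0 ↔ Z.metric.val p v (L p) = 0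
  isCompact_horizonSlice : ∀ c : ℝ, IsCompact (Z.futureEventHorizonOfEnd (Set.range Φ) ∩ {p | t p = c})
  nonexpanding : ∀ [Z.metric.toPseudoRiemannianMetric.HasLeviCivita], ∀ p ∈ Z.futureEventHorizonOfEnd (Set.range Φ), ∀ v w : TangentSpace (𝓡 4) p, Z.metric.val p v (L p) = 0 → Z.metric.val p w (L p) = 0 → Z.metric.val p (Z.metric.leviCivita L p v) w + Z.metric.val p v (Z.metric.leviCivita L p w) = 0

namespace TameEternalLimit

variable (E : TameEternalLimit)

/-- The domain of outer communications `⟨⟨Φ⟩⟩ = I⁺(range Φ) ∩ I⁻(range Φ)` of the far end of the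
limit. [cite: Wald1984, §12.1] -/
def doc : Set E.Z.carrier := E.Z.docOfEnd (Set.range E.Φ)

/-- The future event horizon `𝓗 = ∂I⁻(range Φ) ∩ I⁺(range Φ)` of the far end of the limit
(possibly empty). [cite: HawkingEllis1973, §9.2] -/
def horizon : Set E.Z.carrier := E.Z.futureEventHorizonOfEnd (Set.range E.Φ)

/-- **The limit horizon is red-shifted with surface gravity `κ₀` in the tame frame**: the
clock-normalised generator `L` admits a TAME RENORMALISATION `L' = φ L` — `φ` smooth near `𝓗` and
pinched between two positive constants on `𝓗` — which is pregeodesic with CONSTANT non-affinity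
`κ₀`: `∇_{L'} L' = κ₀ L'` on `𝓗`.  This is the clock-robust form of "surface gravity bounded below in
the normalisation `dt(L) = 1`" (`LorentzianMetric.HasSurfaceGravityGe` for THE clock `t` of the
structure, no existential over clocks: triage r1-1/r1-2): two admissible tame clocks differ by a
reparametrisation with bounded positive derivative, under which a pointwise floor `κ ≥ κ₀` is not
invariant but the existence of a bounded renormalisation to constant `κ₀ > 0` is (it says that the
affine parameter grows exponentially in tame time, two-sidedly); given a pointwise floor and ceiling,
`φ = κ₀ ∫_{-∞}^{s} e^{-∫_σ^s κ} dσ` is the bounded solution of `Lφ + κφ = κ₀`.  A degenerate (cold)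
horizon admits no such `φ` (`φ` would grow linearly).  Vacuous when `𝓗 = ∅`.
[cite: DafermosRodnianski2008, §7.1 Thm. 7.1 and §3.3.2 Prop. 3.3.1] [cite: Wald1984, §12.5] -/
def RedShifted [E.Z.metric.toPseudoRiemannianMetric.HasLeviCivita] (κ₀ : ℝ) : Prop :=
  ∃ (φ : E.Z.carrier → ℝ) (c : ℝ), 0 < c ∧ (∃ 𝒩 : Set E.Z.carrier, IsOpen 𝒩 ∧ E.horizon ⊆ 𝒩 ∧ ContMDiffOn (𝓡 4) 𝓘(ℝ, ℝ) (⊤ : ℕ∞) φ 𝒩) ∧ (∀ p ∈ E.horizon, c⁻¹ ≤ φ p ∧ φ p ≤ c) ∧ ∀ p ∈ E.horizon, E.Z.metric.leviCivita (fun x ↦ φ x • E.L x) p (φ p • E.L p) = κ₀ • (φ p • E.L p)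


/-- **The limit is a (sub-extremal) Kerr black hole**: there are parameters `0 < M'`, `|a| < M'`, an
inner radius `r₁ < r₊(M', a)` and a smooth open embedding `Ψ` of the horizon-penetrating ingoing
Kerr–Schild region `{r > max r₁ 0}` into `Z` which is an ISOMETRY onto its image
(`Ψ^* g_Z = g_{M',a}` pointwise: zero deviation from the Kerr–Schild background) and whose image
covers the closure of the limit's d.o.c. (d.o.c. ∪ horizon).  The Kerr exterior with a collar across
`𝓗⁺`, as the endgame consumes it. [cite: ChruscielCosta2008, Thm. 1.3] -/
def IsKerrBlackHole (E : TameEternalLimit) : Prop :=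
  ∃ (M' a r₁ : ℝ), 0 < M' ∧ |a| < M' ∧ r₁ < Literature.Geometry.Lorentzian.Kerr.rPlus M' a ∧ ∃ Ψ : Literature.Geometry.Lorentzian.Kerr.region a r₁ → E.Z.carrier, ContMDiff 𝓘(ℝ, Literature.Geometry.Lorentzian.E4) (𝓡 4) (⊤ : ℕ∞) Ψ ∧ Topology.IsOpenEmbedding Ψ ∧ closure E.doc ⊆ Set.range Ψ ∧ ∀ x : Literature.Geometry.Lorentzian.Kerr.region a r₁, E.Z.deviation ⟨Literature.Geometry.Lorentzian.Kerr.region a r₁, Literature.Geometry.Lorentzian.Kerr.bilin M' a, fun y ↦ y 0, Literature.Geometry.Lorentzian.Kerr.radius a⟩ Ψ x = 0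

/-- **The limit is flat** (the horizonless outcome): the Levi-Civita connection of `Z` has vanishing
curvature. [cite: Anderson2000, Thm 0.1] -/
def IsFlat (E : TameEternalLimit) [E.Z.metric.toPseudoRiemannianMetric.HasLeviCivita] : Prop :=
  E.Z.metric.leviCivita.IsFlat

section Arises

variable {X : Type} [TopologicalSpace X] [ChartedSpace Literature.Geometry.Lorentzian.E3 X]
  [IsManifold (modelWithCornersSelf ℝ Literature.Geometry.Lorentzian.E3) ((⊤ : ℕ∞) : WithTop ℕ∞) X]
  [ConnectedSpace X] {D : Literature.Geometry.Lorentzian.InitialDataSet (modelWithCornersSelf ℝ Literature.Geometry.Lorentzian.E3) X}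

/-- **`E` is an ω-limit of the development `𝒟` along the base points `p`**: the constant sequence
`(𝒟, p n)` subconverges to `(Z, z)` in the pointed `C²_loc` (Cheeger–Gromov) sense TOGETHER WITH far
charts — some far charts `Φₙ : ℝ × {|x| > R} → 𝒟` of the development converge through the
comparison embeddings to the limit's far chart `Φ`
(`Spacetime.SubconvergesLocallyWithFarChartsTo`, `SpacetimeLocalConvergence.lean`).
[cite: Petersen2006, Ch. 10 §3.2] [cite: Anderson2004, Def. 1.1] -/
def ArisesFrom (𝒟 : Literature.Geometry.Lorentzian.VacuumCauchyDevelopment D) (p : ℕ → 𝒟.carrier) : Prop :=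
  ∃ Φₙ : ℕ → Literature.Geometry.Lorentzian.Kerr.region (0 : ℝ) E.R → 𝒟.carrier,
    Literature.Geometry.Lorentzian.Spacetime.SubconvergesLocallyWithFarChartsTo (fun _ ↦ 𝒟.toSpacetime) p E.Z E.z 2 (farBackground E.M E.R) Φₙ E.Φ

end Arises

end TameEternalLimit

/-! ## §API Projection / vacuity lemmas -/

namespace TameEternalLimit

variable (E : TameEternalLimit)

/-- **The red-shift predicate is vacuous on horizonless limits**: if the future event horizon of the
far end is empty, `E.RedShifted κ₀` holds for EVERY `κ₀` (witness `φ ≡ 1`, `c = 1`, `𝒩 = univ`).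
Recorded because `RedShifted` is the conclusion of stub S2 and the hypothesis of S3/S6: on dispersive
limits those stubs carry no red-shift content. [folklore] -/
theorem redShifted_of_horizon_eq_empty [E.Z.metric.toPseudoRiemannianMetric.HasLeviCivita]
    (h : E.horizon = ∅) (κ₀ : ℝ) : E.RedShifted κ₀ := by
  refine ⟨fun _ ↦ 1, 1, one_pos, ⟨Set.univ, isOpen_univ, Set.subset_univ _, ?_⟩, ?_, ?_⟩
  · exact contMDiffOn_const
  · intro p hp; simp [h] at hp
  · intro p hp; simp [h] at hp

end TameEternalLimit

/-- Registered sub-goal `stub_redShiftedOfHorizonEmpty` (statement of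
`TameEternalLimit.redShifted_of_horizon_eq_empty` as a closed `Prop`). [folklore] -/
theorem stub_redShiftedOfHorizonEmpty :
    ∀ (E : TameEternalLimit) [E.Z.metric.toPseudoRiemannianMetric.HasLeviCivita],
      E.horizon = ∅ → ∀ κ₀ : ℝ, E.RedShifted κ₀ :=
  fun E _ h κ₀ ↦ E.redShifted_of_horizon_eq_empty h κ₀

end Summit.FinalStateConjecture.FinalStateConjecture.Theorems.TrappedSet

end
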